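import Summits.AtomisticToContinuum.Crystallization.Theses.ThreeConeCertificate
import Summits.AtomisticToContinuum.Crystallization.Theorems.ChargedEnergyGap.Negative.BlocksBound
import Summits.AtomisticToContinuum.Crystallization.Theorems.ExactCertificate.Negative.SplitBasics
import Summits.AtomisticToContinuum.Crystallization.Theorems.ThreeConeCertificateExactCertificateClosure
import Summits.AtomisticToContinuum.Crystallization.Theorems.ThreeConeCertificateExactCertificateNoGapIff
import Summits.AtomisticToContinuum.Crystallization.Theorems.ThreeConeCertificateExactCertificateTangency
import Summits.AtomisticToContinuum.Crystallization.Theorems.ThreeConeCertificateExactCertificateSecondMoment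
import Summits.AtomisticToContinuum.Crystallization.Theorems.ThreeConeCertificateExactCertificateFieldInvisible
import Summits.AtomisticToContinuum.Crystallization.Theorems.ThreeConeCertificateExactCertificateFieldNear
import Summits.AtomisticToContinuum.Crystallization.Theorems.ThreeConeCertificateExactCertificateFieldMoving
import Summits.AtomisticToContinuum.Crystallization.Theorems.ThreeConeCertificateExactCertificateFieldCompetitors
import Summits.AtomisticToContinuum.Crystallization.Theorems.ThreeConeCertificateExactCertificateFieldDilation
import Summits.AtomisticToContinuum.Crystallization.Theorems.ThreeConeCertificateExactCertificateFeasible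
import Summits.AtomisticToContinuum.Crystallization.Theorems.ThreeConeCertificateExactCertificateAsymptoticNoGap
import Summits.AtomisticToContinuum.Crystallization.Theorems.ThreeConeCertificateExactCertificateNoGapPeriodicEps

/-!
# Line `closure-makes-nogap-exact` — skeleton for crux `ExactCertificate` (stmt-AtomisticToContinuum-11959)

Crux (route `ThreeConeCertificate`, rank 3):
`Summit.AtomisticToContinuum.Crystallization.Theses.ThreeConeCertificate.ExactCertificate` —
`∃ P ρ c g U f`, (S1) `V_LJ = g + U + f` on `(0,∞)`, (S2) `U ≥ 0` on `(0,∞)`, (S3) `g ≡ 0` on `[ρ,∞)`,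
(S4) `f` radially of positive type on `ℝ³` (finite quadratic forms), (S5) `g` is `c`-stable on finite
injective configurations, (S6) `c + f 0 / 2 = −e_LJ(P)`.

THE LINE (idea card `Ideas/closure-makes-nogap-exact.md`, triage r1: pass ×3).  Attainment is free:
the three certificate cones are closed under pointwise ultralimits, so the crux is an INFIMUM statement.
With the standing disprover's factorisation (`Disproof.exactCertificate_iff_sharp_and_kepler`:
`ExactCertificate ↔ SharpSplit ∧ KeplerBound`, `KeplerBound ↔ PeriodicMinimiser`) the crux is
EQUIVALENT to the conjunction of the two open stubs below, glued by the closure stub: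

* `stub_closure` (THE LEVER, provable now, size M): at a fixed range `ρ` the set of certificate values
  `{c + f 0/2 : (c,g,U,f) a range-ρ split}` is closed at every level `v`: if splits with value `≤ v + ε`
  exist for all `ε > 0`, one with value `≤ v` exists.  (Pointwise ultralimit / Tychonoff cluster point of
  the bounded data `0 ≤ c_j ≤ v+1`, `|f_j r| ≤ f_j 0 ≤ 2(v+1)`, `−2c_j ≤ g_j r ≤ V r + f_j 0`,
  `0 ≤ U_j r ≤ V r + 2c_j + f_j 0` for `r > 0`; values at `r ≤ 0` other than `f 0` enter no clause and are
  zeroed; every clause is a finite linear (in)equality in the values, hence preserved.)  No `e*`, no `P`.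
* `stub_noGap` (THE CONTENT, open; hardest): NO DUALITY GAP FOR THE THREE-CONE PROGRAMME AT SOME FINITE
  RANGE `ρ₀`, in the certifiable two-slack normal form of the sibling card `tail-first-bochner-completion`:
  for every `ε > 0` there are a periodic TEMPLATE `Q` (may depend on `ε`: rational approximants of relaxed
  hcp) and a radial positive-type `f` with `f ≤ V_LJ` beyond `ρ₀` such that
  (tail) `f 0 + 2e_Q(f·1_{(0,ρ₀)}) + 2e_Q(V_LJ·1_{[ρ₀,∞)}) ≤ ε` — the inner `Q`-sum of `f` is within `ε` of
  the tail budget `2|e_T(Q,ρ₀)|` (= `innerFunctional − tailTwice` of the sibling sketch) — and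
  (core) `Q` is an `ε`-per-particle ground state of the EXPLICIT finite-range potential
  `g_f := (V_LJ − f)·1_{(0,ρ₀)}` among ALL finite configurations.  Each `ε`-instance is a finite
  certificate (LP-designed `f` with rational data + interval-certified local constant); the stub is the
  convergence statement.  It is `Disproof.SharpSplit` in `ε`-form (equivalent to `∃ ρ, NoGapAt ρ`).
* `stub_periodicMinimum` (open-problem, SHARED): the periodic infimum `e* = ⨅_Q e_LJ(Q)` is attained.
  This is `Disproof.PeriodicMinimiser ↔ KeplerBound` (route item 11961) `↔ HasPeriodicGroundStateEnergy`
  (conjunct (i)); the disprover PROVED it necessary for the crux, so every line must carry it; this line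
  adds nothing to it and keeps it separate so that `stub_noGap` stays template-free.

STATUS (line lead, 2026-08-16, final for this seat).  Registered stubs: 7.  CLOSED (landed, imported
here, no `sorry`): `stub_closure` (p85389, `…Theorems.ThreeConeCertificateExactCertificateClosure`),
`stub_contact` (p86744, `…SlacknessBlocks`), `stub_coneEnergies` (p91815, `…SlacknessEnergy`),
`stub_necessity` (p91831, `…NoGapNecessary`), `stub_iff` (p94242, `…NoGapIff`).  OPEN (the only `sorry`s
left): `stub_noGap` — proved EQUIVALENT to `SharpSplit := ∃ ρ c g U f, IsSplit ρ c g U f ∧ c + f 0/2 = −e*`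
(`…NoGap.noGap_iff_sharpSplit`) and to the crux itself modulo `stub_periodicMinimum`
(`…NoGap.stub_iff`, `…Slackness.stub_necessity`): it is crux-sized (handed back: promote-stub);
`stub_periodicMinimum` — `↔ KeplerBound` (item 11961; p85536 `…PeriodicMinimum`).  In the tree:
`ExactCertificate ↔ SharpSplit ∧ (∃ periodic minimiser)` (`…NoGap.exactCertificate_iff_sharpSplit_and_periodicMinimum`).

Composition `ExactCertificate_of` (sorry-free apart from the two open stubs): `stub_noGap` + the normal-form
split `g := (V−f)1_{(0,ρ₀)}`, `U := (V−f)1_{[ρ₀,∞)}`, `c := ε − e_Q(g)` and the lattice-sum accounting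
`c + f 0/2 = CoreSlack + ½·TailSlack − e(Q) ≤ −e* + 2ε` give near-optimal splits at range `ρ₀`;
`stub_closure` at level `v = −e*` gives a split of value `≤ −e*`; weak duality (`value_ge`, re-proved here
from the tree's `exists_trialState`, = `Disproof.IsSplit.value_ge`) gives `≥ −e*`; `stub_periodicMinimum`
gives `P` with `e(P) = e*`; hence (S6) with `=`.

Disproof.lean (cdisprove cycle 1) honoured: `IsSplit.value_ge` is the floor that makes `v = −e*` the right
level (re-proved below, not imported: Disproof.lean is a living work file); `exactCertificate_iff_le`
(`=` vs `≤`) is the `ε = 0` case of `stub_closure`; `not_exact_with_f_zero_eq_zero` / `f_zero_pos` and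
`c_nonneg` are exactly the boundedness inputs of the closure proof; `exactAt_mono`: `stub_closure` is stated
for every range, and `stub_noGap` (`∃ ρ₀`) is equivalent to `∃ ρ, NoGapAt ρ`, an up-set by `IsSplit.mono`;
`withoutFiniteRange_iff_keplerBound`: the template in `stub_noGap` moves with `ε`, so the stub does NOT
smuggle attainment (that is `stub_periodicMinimum`); §4 (`U_eq_zero_of_mem_points`,
`f_eq_lennardJones_of_mem_points`, `energyPerParticle_g_eq`, `f_zero_add_two_mul_energyPerParticle_f`)
shows `stub_noGap` is NECESSARY: a crux witness `(P, ρ, c, g, U, f)` satisfies it with `ρ₀ = ρ`, `Q = P`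
constant and the same `f` (both slacks vanish), so crux `↔ stub_noGap ∧ stub_periodicMinimum` — the
skeleton is tight, no stub is stronger than the crux requires.
Landed `Negative/` lemma imported: `SplitBasics` (`IsSplit`, `value_ge`, `kepler`, …).

LEAD'S RESHAPE (line lead, 2026-08-16): the skeleton now uses the LANDED `IsSplit` of
`Theorems/ExactCertificate/Negative/SplitBasics.lean` (cdisprove, p83812; verbatim the conjunction (S1)–(S5))
instead of a local copy, `stub_closure` is the landed theorem (p85389), and four NECESSITY stubs are
registered next to the three original ones so that the tightness claims above become landed theorems of the
tree: `stub_contact` (`U = 0` on `D_P`, `f = V_LJ` on `D_P ∩ [ρ,∞)` for a witness), `stub_coneEnergies`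
(`e_P(g) = −c`, `e_P(U) = 0`, `f 0 + 2e_P(f) = 0`), `stub_necessity` (`ExactCertificate → stub_noGap ∧
stub_periodicMinimum`, signatures verbatim) and `stub_iff` (`ExactCertificate ↔ stub_noGap ∧
stub_periodicMinimum`).  `ExactCertificate_of` still composes `stub_noGap`, `stub_closure`,
`stub_periodicMinimum` through the glue below; `ExactCertificate_iff_stubs` records the equivalence.

All stub statements are written over existing declarations only (no local definition occurs in a stub),
under `open Literature.MathematicalPhysics.StatisticalMechanics`.

LEAD GEN-1 CONTINUATION RESHAPE (v3, 2026-08-16): the two load-bearing stubs `stub_noGap` (↔ `SharpSplit`,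
open-problem, promoted) and `stub_periodicMinimum` (↔ `KeplerBound` 11961) are unchanged and remain the only
inputs of `ExactCertificate_of`.  Four further NECESSITY stubs are registered — each provable now, each a
condition every witness `(P, ρ, c, g, U, f)` (or every witness template `P`) must satisfy, i.e. the formal
shape of the route's structural kill criterion (2) ("no one-sided radial interpolant"):
* `stub_dilate` — dilation of periodic configurations (`t • P` is a periodic configuration with
  `e_W(t • P) = e_{W(t·)}(P)`); infrastructure for every zero-pressure argument (existence form, no new def);
* `stub_zeroPressure` — the VIRIAL IDENTITY at zero pressure: if `P` does not gain under dilation of the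
  potential (`e_LJ(P) ≤ e_{LJ(t·)}(P)` for all `t > 0`, which a periodic minimiser / witness template
  satisfies by `stub_dilate`), then `Σ' r⁻⁶ = Σ' r⁻¹²` over `P` (per-particle lattice sums),
  `e_LJ(P) = −e₆(P)/12`, and the DILATION EXCESS is explicit: `e_{LJ(t·)}(P) − e_LJ(P) = (e₆(P)/12)(t⁻⁶ − 1)²`;
* `stub_tangency` — C¹ CONTACT: at every distance `r ∈ D_P` with `r > ρ` the slack `U = V_LJ − f` is squeezed
  quadratically, `0 ≤ V_LJ(s) − f(s) ≤ C (s − r)²` near `r`, hence `f` is differentiable at `r` with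
  `f'(r) = V_LJ'(r)` (the `U`-slack of the dilated template `(s/r) • P` is `≤ e((s/r)•P) − e(P) = O((s−r)²)`,
  and the distance `s` is realised `≳ K³` times in its `K`-blocks) — so a witness `f` is a one-sided
  C¹-interpolant of `V_LJ` on the whole distance set of `P` beyond `ρ`, the hypothesis of every
  interpolation-obstruction heuristic (BarrierNotesIdeator3 §2, NegativeNotesIdeator1 B3);
* `stub_structureFactor` — FOURIER-SIDE SLACKNESS WITHOUT FOURIER TRANSFORMS: the `f`-weighted structure
  factor of the template, `S_f(k) = f 0 + (1/#F) Σ_{x ∈ F} Σ'_{y ∈ P} cos⟪k, x − y⟫ f(|x − y|)`, is `≥ 0`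
  for every `k ∈ ℝ³` (positive type tested with the weights `cos⟪k,·⟫`, `sin⟪k,·⟫` on blocks) and `= 0` at
  `k = 0` (= `stub_coneEnergies` (iii)): `k = 0` is a global minimum of `S_f` — in Fourier language
  `𝓕f·|S_P|²` vanishes on the reciprocal lattice and `∫ f = 0`.
Glue added below (sorry-free modulo the stubs): `zeroPressure_of_periodicMinimum`, `zeroPressure_of_witness`.

LEAD c5 (v6, 2026-08-16): no stub changed (the ONLY `sorry`s remain `stub_noGap` and `stub_periodicMinimum`).  Added the
route-level DECOMPOSITION, landed as `Theorems/ThreeConeCertificateExactCertificateSplit.lean` (p116973; namespace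
`…Theorems.ThreeConeCertificateExactCertificate.Split`, importable — not imported by this skeleton, which it does not need):
`Split.ExactCertificate_of_subs : stub_noGap-statement → KeplerBound → ExactCertificate` (registered sub-goal, closed),
`Split.ExactCertificate_iff_subs : ExactCertificate ↔ stub_noGap-statement ∧ KeplerBound`,
`Split.exactCertificate_iff_noGap_of_keplerBound`, and `Split.crystallization_of_keplerBound_of_slackRigidity :
KeplerBound → SlackRigidity → Crystallization` (the route's `closes` with every provable hypothesis discharged: the crux is not
load-bearing in `closes`; its energetic content for the route is item 11961).  `ExactCertificate_of` below is unchanged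
(`ExactCertificate_iff_stubs.2 ⟨stub_noGap, stub_periodicMinimum⟩`); `Split.ExactCertificate_of_subs stub_noGap
(keplerBound_of_periodicMinimum stub_periodicMinimum)` is the same composition in route-level typing.
Verdict of this seat: line COMPLETE (an equivalence) and DEAD as a prover line (L5: it leans on item 11961 ↔ 0627, open problem,
and on SharpSplit, crux-sized) — `Lines/closure-makes-nogap-exact-dead.md`.

LEAD c2 CONTINUATION RESHAPE (v4/v5, 2026-08-16; v5 = every stub below that says LANDED is the imported tree theorem).  Every stub landed by leads −0, −1 and c1 is now IMPORTED and its
skeleton entry is the landed theorem (no `sorry`): `stub_dilate` (p96706), `stub_zeroPressure` (p97155),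
`stub_structureFactor` (p97420), `stub_tangency` (p98763), `stub_secondMoment` (p101492), the Field chain
`stub_cosetSummable` (p98572) / `stub_periodisationPosType` (p101701) / `stub_invisible` (p104609), the load-bearing
`stub_withoutStability` (p107137) and `stub_asymptoticKernel` (p107933).  The ONLY `sorry`s left (v5) are the two OPEN
inputs of `ExactCertificate_of` (`stub_noGap` ↔ SharpSplit, `stub_periodicMinimum` ↔ KeplerBound = item 11961).  The stubs c1
registered with proofs in hand whose files were lost with its session were re-proved and LANDED by this seat (all imported):
* `stub_asymptoticNoGap` (lead) — ASYMPTOTIC NO-GAP: for every `ε > 0` a finite-range split with `c + f 0/2 ≤ −e* + ε`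
  (range `ρ → ∞`, the cheap Bochner cone `f_ρ` of `stub_asymptoticKernel`, remainder `(V_LJ − f_ρ)1_{(0,ρ)}` compared
  pointwise with `(1−μ)V_LJ + μ·8V_LJ(4^{1/6}·)`, `μ = 810ρ^{−3/2}`, stability from `N e* ≤ E_LJ` and the tree's
  `−(2³²/12)N ≤ E_LJ`); with `IsSplit.value_ge` the infimum of the three-cone programme over all finite ranges is EXACTLY
  `−e*`, so `stub_noGap` is precisely ATTAINMENT of that infimum at a finite range;
* `stub_existsSplit` — a stable split exists (corollary, `ε = 1`; completes the load-bearing table with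
  `stub_withoutStability`: (S5) or (S6) dropped ⇒ the crux holds);
* `stub_competitorNeutrality` — for a witness and EVERY periodic `Q`: `0 ≤ f 0 + 2e_f(Q) ≤ 2(e(Q) − e(P))`;
* `stub_dilationDefect` — `0 ≤ f 0 + 2e_P(f(t·)) ≤ (e₆(P)/6)(t⁻⁶ − 1)²` for all `t > 0`;
* `stub_templateNeutrality` — moving-template neutrality `0 ≤ f 0 + 2e_Q(f) ≤` tail slack, no witness assumed;
* `stub_nearDefect` — the LP rows at every probe point `w` (only `f|[0,ρ)` enters).
-/

noncomputable section

namespace Summit.AtomisticToContinuum.Crystallization.Cruxes.ExactCertificate.ClosureMakesNogapExact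

open Literature.MathematicalPhysics.StatisticalMechanics
open Summit.AtomisticToContinuum.Crystallization.Theses.ThreeConeCertificate
open Summit.AtomisticToContinuum.Crystallization.Theorems.ChargedEnergyGapNegative
  (eStar eStar_le exists_trialState bddBelow_energyPerParticle_lennardJones)
open Summit.AtomisticToContinuum.Crystallization.Theorems.ExactCertificateNegative (IsSplit)
open scoped BigOperators

/-! ## The registered stubs (3 original + 4 necessity stubs) -/

/-- **stub_closure — the closure lemma (the lever; provable now, size M).**  At a fixed range `ρ`, the
set of values `c + f 0 / 2` of range-`ρ` three-cone splits of `V_LJ` is closed at every level `v`: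
near-`v` splits for all `ε > 0` give a split of value `≤ v`.  Proof sketch: choose splits `S_j` with
values `≤ v + 1/(j+1)`; for `r > 0` all data are bounded (`0 ≤ c_j ≤ v + 1` by `N = 1` stability and
`f_j 0 ≥ 0`; `|f_j r| ≤ f_j 0 ≤ 2(v+1)` by the `n = 2` forms; `−2c_j ≤ g_j r ≤ V r + f_j 0` by `N = 2`
stability and `U_j ≥ 0`; `0 ≤ U_j r ≤ V r + 2c_j + f_j 0`); zero the values that enter no clause
(`g_j, U_j` at `r ≤ 0`, `f_j` at `r < 0`); take a cluster point in the compact product of these intervals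
(`isCompact_univ_pi` + `IsCompact.exists_clusterPt`, or an `Ultrafilter`/`Hyperreal.st` limit): every
clause is a closed condition on finitely many coordinates, and the value is eventually `≤ v + δ`. -/
theorem stub_closure : ∀ (ρ v : ℝ),
    (∀ ε : ℝ, 0 < ε → ∃ (c : ℝ) (g U f : ℝ → ℝ),
      ((∀ r : ℝ, 0 < r → lennardJones r = g r + U r + f r) ∧
        (∀ r : ℝ, 0 < r → 0 ≤ U r) ∧
        (∀ r : ℝ, ρ ≤ r → g r = 0) ∧
        (∀ (n : ℕ) (y : Fin n → EuclideanSpace ℝ (Fin 3)) (w : Fin n → ℝ),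
          0 ≤ ∑ i, ∑ j, w i * w j * f (dist (y i) (y j))) ∧
        (∀ (N : ℕ) (x : Fin N → EuclideanSpace ℝ (Fin 3)), Function.Injective x →
          -(c * (N : ℝ)) ≤ interactionEnergy g x)) ∧
      c + f 0 / 2 ≤ v + ε) →
    ∃ (c : ℝ) (g U f : ℝ → ℝ),
      ((∀ r : ℝ, 0 < r → lennardJones r = g r + U r + f r) ∧
        (∀ r : ℝ, 0 < r → 0 ≤ U r) ∧
        (∀ r : ℝ, ρ ≤ r → g r = 0) ∧
        (∀ (n : ℕ) (y : Fin n → EuclideanSpace ℝ (Fin 3)) (w : Fin n → ℝ),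
          0 ≤ ∑ i, ∑ j, w i * w j * f (dist (y i) (y j))) ∧
        (∀ (N : ℕ) (x : Fin N → EuclideanSpace ℝ (Fin 3)), Function.Injective x →
          -(c * (N : ℝ)) ≤ interactionEnergy g x)) ∧
      c + f 0 / 2 ≤ v :=
  -- LANDED (wave 1, p85389): `Theorems/ThreeConeCertificateExactCertificateClosure.lean`.
  Summit.AtomisticToContinuum.Crystallization.Theorems.ThreeConeCertificateExactCertificate.stub_closure

/-- **stub_noGap — no duality gap at some finite range, two-slack normal form (the content; open,
hardest).**  At some range `ρ₀`: for every `ε > 0` there are a periodic template `Q` and a radial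
positive-type `f` lying below `V_LJ` beyond `ρ₀` with
(tail slack) `f 0 + 2·e_Q(f·1_{(0,ρ₀)}) + 2·e_Q(V_LJ·1_{[ρ₀,∞)}) ≤ ε`, i.e. the inner `Q`-sum of `f`,
self-term included, is within `ε` of the tail budget `2|e_T(Q,ρ₀)|` (always `≥ 0`: Bochner on `Q`-blocks
and `f ≤ V_LJ` on the tail — sibling lemma `tail_lower_bound`), and
(core slack) `Q` is an `ε`-approximate per-particle ground state of the explicit finite-range potential
`g_f = (V_LJ − f)·1_{(0,ρ₀)}` among ALL finite injective configurations (always `≥`-tight from the other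
side by testing on `Q`-blocks).  Equivalent (given `stub_closure` and the two weak-duality floors) to the
disprover's `SharpSplit` / to `∃ ρ, NoGapAt ρ` (an up-set in `ρ`); does not imply attainment (the template
moves with `ε`); NECESSARY for the crux (a witness satisfies it with `Q = P`, both slacks `= 0`, Disproof §4). -/
theorem stub_noGap : ∃ ρ₀ : ℝ, ∀ ε : ℝ, 0 < ε →
    ∃ (Q : PeriodicConfiguration 3) (f : ℝ → ℝ),
      (∀ (n : ℕ) (y : Fin n → EuclideanSpace ℝ (Fin 3)) (w : Fin n → ℝ),
        0 ≤ ∑ i, ∑ j, w i * w j * f (dist (y i) (y j))) ∧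
      (∀ r : ℝ, ρ₀ ≤ r → 0 < r → f r ≤ lennardJones r) ∧
      f 0 + 2 * Q.energyPerParticle (fun r => if r < ρ₀ then f r else 0)
          + 2 * Q.energyPerParticle (fun r => if r < ρ₀ then 0 else lennardJones r) ≤ ε ∧
      (∀ (N : ℕ) (x : Fin N → EuclideanSpace ℝ (Fin 3)), Function.Injective x →
        (N : ℝ) * (Q.energyPerParticle (fun r => if r < ρ₀ then lennardJones r - f r else 0) - ε) ≤
          interactionEnergy (fun r => if r < ρ₀ then lennardJones r - f r else 0) x) := by
  sorry

/-- **stub_periodicMinimum — the periodic infimum of `e_LJ` over periodic configurations of `ℝ³` is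
attained (open-problem; SHARED).**  By the standing Disproof (§2: `keplerBound_iff_periodicMinimiser`,
`periodicMinimiser_iff_conjunct_i`) this is equivalent to route item 11961 `KeplerBound` and to conjunct
(i) `HasPeriodicGroundStateEnergy V_LJ 3`, and it is NECESSARY for the crux (`periodicMinimum_of_exact`
below).  Kept as a separate stub so that `stub_noGap` stays template-free. -/
theorem stub_periodicMinimum : ∃ P : PeriodicConfiguration 3, ∀ Q : PeriodicConfiguration 3,
    P.energyPerParticle lennardJones ≤ Q.energyPerParticle lennardJones := by
  sorry

/-- **stub_contact — complementary slackness on the distance set (NECESSITY side; provable now, M).**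
For a witness split attaining a periodic `P` (`c + f 0/2 ≤ −e(P)`): the slack `U` vanishes at every
distance realised by two points of `P`, and hence `f = V_LJ` at every such distance `≥ ρ` (pair counting
in `K`-blocks of `P` against the `o(N)` `U`-slack; Disproof §4). -/
theorem stub_contact : ∀ (P : PeriodicConfiguration 3) (ρ c : ℝ) (g U f : ℝ → ℝ),
    IsSplit ρ c g U f → c + f 0 / 2 ≤ -(P.energyPerParticle lennardJones) →
    ∀ p ∈ P.points, ∀ q ∈ P.points, p ≠ q →
      U (dist p q) = 0 ∧ (ρ ≤ dist p q → f (dist p q) = lennardJones (dist p q)) :=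
  Summit.AtomisticToContinuum.Crystallization.Theorems.ThreeConeCertificateExactCertificate.Slackness.stub_contact

/-- **stub_coneEnergies — the periodic energies of the three cones of a witness (NECESSITY side;
provable now, M).**  `e_P(g) = −c` (block identity for finite-range potentials + `g`-slack + stability),
`e_P(U) = 0`, and `f 0 + 2e_P(f) = 0` (the `P`-sum of `f` including the self-term vanishes; Disproof §4). -/
theorem stub_coneEnergies : ∀ (P : PeriodicConfiguration 3) (ρ c : ℝ) (g U f : ℝ → ℝ),
    IsSplit ρ c g U f → c + f 0 / 2 ≤ -(P.energyPerParticle lennardJones) →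
    P.energyPerParticle g = -c ∧ P.energyPerParticle U = 0 ∧ f 0 + 2 * P.energyPerParticle f = 0 :=
  Summit.AtomisticToContinuum.Crystallization.Theorems.ThreeConeCertificateExactCertificate.Slackness.stub_coneEnergies

/-- **stub_necessity — the crux implies both open stubs (NECESSITY side; provable now from
`stub_contact` + `stub_coneEnergies`, S).**  A witness `(P, ρ, c, g, U, f)` satisfies `stub_noGap` with
`ρ₀ := ρ`, `Q := P` and its own `f` at every `ε` (tail functional `= f 0 + 2e_P(f) = 0`; core constant
`e_P((V_LJ − f)1_{<ρ}) = e_P(g) = −c` and `(V_LJ − f)1_{(0,ρ)} = g + U1_{(0,ρ)} ≥ g` is `c`-stable), and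
`P` is a periodic minimiser (weak duality).  Signatures of `stub_noGap` / `stub_periodicMinimum` verbatim. -/
theorem stub_necessity : ExactCertificate →
    (∃ ρ₀ : ℝ, ∀ ε : ℝ, 0 < ε → ∃ (Q : PeriodicConfiguration 3) (f : ℝ → ℝ),
      (∀ (n : ℕ) (y : Fin n → EuclideanSpace ℝ (Fin 3)) (w : Fin n → ℝ),
        0 ≤ ∑ i, ∑ j, w i * w j * f (dist (y i) (y j))) ∧
      (∀ r : ℝ, ρ₀ ≤ r → 0 < r → f r ≤ lennardJones r) ∧
      f 0 + 2 * Q.energyPerParticle (fun r => if r < ρ₀ then f r else 0) +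
          2 * Q.energyPerParticle (fun r => if r < ρ₀ then 0 else lennardJones r) ≤ ε ∧
      (∀ (N : ℕ) (x : Fin N → EuclideanSpace ℝ (Fin 3)), Function.Injective x →
        (N : ℝ) * (Q.energyPerParticle (fun r => if r < ρ₀ then lennardJones r - f r else 0) - ε) ≤
          interactionEnergy (fun r => if r < ρ₀ then lennardJones r - f r else 0) x)) ∧
    (∃ P : PeriodicConfiguration 3, ∀ Q : PeriodicConfiguration 3,
      P.energyPerParticle lennardJones ≤ Q.energyPerParticle lennardJones) :=
  Summit.AtomisticToContinuum.Crystallization.Theorems.ThreeConeCertificateExactCertificate.Slackness.stub_necessity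

/-- **stub_iff — THE LINE IS AN EQUIVALENCE (provable now from `stub_necessity` + `stub_closure` + the
glue, S):** `ExactCertificate ↔ stub_noGap ∧ stub_periodicMinimum` (signatures verbatim).  So the crux
factors exactly into "no three-cone duality gap at some finite range" (`P`-free up to `ε`) and "the
periodic infimum of `e_LJ` is attained" (= item 11961 `KeplerBound`). -/
theorem stub_iff : ExactCertificate ↔
    (∃ ρ₀ : ℝ, ∀ ε : ℝ, 0 < ε → ∃ (Q : PeriodicConfiguration 3) (f : ℝ → ℝ),
      (∀ (n : ℕ) (y : Fin n → EuclideanSpace ℝ (Fin 3)) (w : Fin n → ℝ),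
        0 ≤ ∑ i, ∑ j, w i * w j * f (dist (y i) (y j))) ∧
      (∀ r : ℝ, ρ₀ ≤ r → 0 < r → f r ≤ lennardJones r) ∧
      f 0 + 2 * Q.energyPerParticle (fun r => if r < ρ₀ then f r else 0) +
          2 * Q.energyPerParticle (fun r => if r < ρ₀ then 0 else lennardJones r) ≤ ε ∧
      (∀ (N : ℕ) (x : Fin N → EuclideanSpace ℝ (Fin 3)), Function.Injective x →
        (N : ℝ) * (Q.energyPerParticle (fun r => if r < ρ₀ then lennardJones r - f r else 0) - ε) ≤
          interactionEnergy (fun r => if r < ρ₀ then lennardJones r - f r else 0) x)) ∧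
    (∃ P : PeriodicConfiguration 3, ∀ Q : PeriodicConfiguration 3,
      P.energyPerParticle lennardJones ≤ Q.energyPerParticle lennardJones) :=
  Summit.AtomisticToContinuum.Crystallization.Theorems.ThreeConeCertificateExactCertificate.NoGap.stub_iff

/-! ## Necessity stubs registered by the gen-1 continuation lead (v3; all provable now) -/

/-- **stub_dilate — dilation of periodic configurations (infrastructure; provable now, S/M).**  For
`t > 0` the dilate `t • P` (lattice `t • G`, motif `t • F`) is again a periodic configuration of `ℝ³`
with the same number of motif points, point set `t • (F + G)`, and energy per particle
`e_W(t • P) = e_{W(t·)}(P)` for EVERY pair potential `W` (reindex the lattice sum by `y ↦ t • y`,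
`dist (t•x) (t•y) = t·dist x y`).  Existence form over existing declarations (no new definition is
posited); cf. `PeriodicConfiguration.translate` / `.isometryImage` in
`Literature/…/CrystallizationSymmetries.lean` (`ZLattice.comap` by the linear equivalence `t⁻¹ • id`). -/
theorem stub_dilate : ∀ (P : PeriodicConfiguration 3) (t : ℝ), 0 < t →
    ∃ Q : PeriodicConfiguration 3, Q.motif.card = P.motif.card ∧
      Q.points = (fun x : EuclideanSpace ℝ (Fin 3) => t • x) '' P.points ∧
      ∀ W : ℝ → ℝ, Q.energyPerParticle W = P.energyPerParticle (fun r => W (t * r)) :=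
  -- LANDED (lead −1, p96706): `Theorems/ThreeConeCertificateExactCertificateDilate.lean`.
  Summit.AtomisticToContinuum.Crystallization.Theorems.ThreeConeCertificateExactCertificate.Dilation.stub_dilate

/-- **stub_zeroPressure — the virial identity and the explicit dilation excess (provable now, M).**
If a periodic configuration `P` of `ℝ³` does not gain energy when the Lennard-Jones potential is
dilated (`e_LJ(P) ≤ e_{LJ(t·)}(P)` for all `t > 0`; by `stub_dilate` this holds for every periodic
minimiser, in particular for every witness template of the crux), then, with the per-particle lattice
sums `e₆(P) = e_{r⁻⁶}(P)`, `e₁₂(P) = e_{r⁻¹²}(P)` (absolutely convergent, `summable_inv_pow_dist`):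
(i) ZERO PRESSURE / VIRIAL: `e₆(P) = e₁₂(P)`; (ii) `e_LJ(P) = −e₆(P)/12`; (iii) for every `t > 0`,
`e_{LJ(t·)}(P) − e_LJ(P) = (e₆(P)/12)·(t⁻⁶ − 1)²`.  Proof: `φ(t) := e_{LJ(t·)}(P) = (e₁₂/12)t⁻¹² − (e₆/6)t⁻⁶`
by linearity of the lattice sums; `φ ≥ φ(1)` on `(0,∞)` forces `φ'(1) = −e₁₂ + e₆ = 0`; then algebra. -/
theorem stub_zeroPressure : ∀ P : PeriodicConfiguration 3,
    (∀ t : ℝ, 0 < t →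
      P.energyPerParticle lennardJones ≤ P.energyPerParticle (fun r => lennardJones (t * r))) →
    P.energyPerParticle (fun r => (r⁻¹) ^ 6) = P.energyPerParticle (fun r => (r⁻¹) ^ 12) ∧
    P.energyPerParticle lennardJones = -(1 / 12) * P.energyPerParticle (fun r => (r⁻¹) ^ 6) ∧
    ∀ t : ℝ, 0 < t →
      P.energyPerParticle (fun r => lennardJones (t * r)) - P.energyPerParticle lennardJones =
        (1 / 12) * P.energyPerParticle (fun r => (r⁻¹) ^ 6) * ((t⁻¹) ^ 6 - 1) ^ 2 :=
  -- LANDED (lead −1, p97155): `Theorems/ThreeConeCertificateExactCertificateZeroPressure.lean`.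
  Summit.AtomisticToContinuum.Crystallization.Theorems.ThreeConeCertificateExactCertificate.Dilation.stub_zeroPressure

/-- **stub_tangency — C¹ contact of `f` with `V_LJ` on the distance set beyond the range (provable
now, M/L).**  For a witness split attaining a periodic `P` and a distance `r = dist p q` of `P` with
`r > ρ`: the slack `U = V_LJ − f` (recall `g = 0` beyond `ρ`) is squeezed quadratically near `r`,
`0 ≤ V_LJ(s) − f(s) ≤ C·(s − r)²` for `|s − r| < δ`, and consequently `f` is differentiable at `r` with
`f'(r) = V_LJ'(r)`.  Mechanism: the `U`-energy of the `K`-blocks of the dilated template `(s/r) • P`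
(`stub_dilate`) is at most `N_K·(e_LJ((s/r)•P) − e_LJ(P)) + o(N_K)` (stability of `g`, the Bochner bound
for `f`, `c + f 0/2 ≤ −e(P)`, block trial states `Blocks.exists_block_energy_le`), the distance `s` is
realised `≥ K³ − 6MK²` times there (`Slackness.sub_mul_le_two_mul_energy`), and
`e_LJ((s/r)•P) − e_LJ(P) = (e₆(P)/12)((r/s)⁶ − 1)² = O((s − r)²)` (`stub_zeroPressure`, or directly: the
two-term dilation curve has its minimum at `1` by weak duality `eStar_le`). -/
theorem stub_tangency : ∀ (P : PeriodicConfiguration 3) (ρ c : ℝ) (g U f : ℝ → ℝ),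
    IsSplit ρ c g U f → c + f 0 / 2 ≤ -(P.energyPerParticle lennardJones) →
    ∀ p ∈ P.points, ∀ q ∈ P.points, p ≠ q → ρ < dist p q →
      (∃ C δ : ℝ, 0 < δ ∧ ∀ s : ℝ, |s - dist p q| < δ →
        0 ≤ lennardJones s - f s ∧ lennardJones s - f s ≤ C * (s - dist p q) ^ 2) ∧
      HasDerivAt f (deriv lennardJones (dist p q)) (dist p q) :=
  -- LANDED (lead −1, p98763): `Theorems/ThreeConeCertificateExactCertificateTangency.lean`.
  Summit.AtomisticToContinuum.Crystallization.Theorems.ThreeConeCertificateExactCertificate.Contact.stub_tangency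

/-- **stub_structureFactor — the `f`-weighted structure factor of the template is non-negative and
vanishes at `k = 0` (Fourier-side complementary slackness; provable now, M/L).**  For a witness split
attaining `P`: for every wave vector `k ∈ ℝ³`,
`S_f(k) := f 0 + (#F)⁻¹ Σ_{x ∈ F} Σ'_{y ∈ F+G, y ≠ x} cos⟪k, x − y⟫ · f(|x − y|) ≥ 0`,
and `S_f(0) = 0`.  Mechanism: test (S4) on the `K`-blocks of `P` with the two weight vectors
`w_i = cos⟪k, y_i⟫` and `w_i = sin⟪k, y_i⟫` and add (`cos a cos b + sin a sin b = cos (a − b)`); divide by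
`N_K` and let `K → ∞` (the site families `y ↦ f(dist x y)` are absolutely summable for a witness,
`Slackness.summable_f_site`, so block double sums of the translation-invariant kernel converge to the
periodic site sums; the self-terms give `f 0`).  The value at `k = 0` is `f 0 + 2e_f(P) = 0`
(`stub_coneEnergies` (iii)).  In Fourier language: `𝓕f·|S_P|² = 0` on the reciprocal lattice, `∫f = 0`. -/
theorem stub_structureFactor : ∀ (P : PeriodicConfiguration 3) (ρ c : ℝ) (g U f : ℝ → ℝ),
    IsSplit ρ c g U f → c + f 0 / 2 ≤ -(P.energyPerParticle lennardJones) →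
    (∀ k : EuclideanSpace ℝ (Fin 3),
      0 ≤ f 0 + ((P.motif.card : ℝ))⁻¹ * ∑ x ∈ P.motif,
        ∑' y : {y : EuclideanSpace ℝ (Fin 3) // y ∈ P.points ∧ y ≠ x},
          Real.cos (inner ℝ k (x - y.1)) * f (dist x y.1)) ∧
    f 0 + ((P.motif.card : ℝ))⁻¹ * ∑ x ∈ P.motif,
        ∑' y : {y : EuclideanSpace ℝ (Fin 3) // y ∈ P.points ∧ y ≠ x}, f (dist x y.1) = 0 :=
  -- LANDED (lead −1, p97420): `Theorems/ThreeConeCertificateExactCertificateStructureFactor.lean`.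
  Summit.AtomisticToContinuum.Crystallization.Theorems.ThreeConeCertificateExactCertificate.Fourier.stub_structureFactor

/-- **stub_secondMoment — second moments of the `f`-weighted pair statistics are `≤ 0` in every direction (PSD
Hessian of the structure factor at `k = 0`; NECESSITY side).** -/
theorem stub_secondMoment : ∀ (P : PeriodicConfiguration 3) (ρ c : ℝ) (g U f : ℝ → ℝ),
    IsSplit ρ c g U f → c + f 0 / 2 ≤ -(P.energyPerParticle lennardJones) →
    ∀ u : EuclideanSpace ℝ (Fin 3),
      (∀ x ∈ P.motif, Summable fun y : {y : EuclideanSpace ℝ (Fin 3) // y ∈ P.points ∧ y ≠ x} =>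
        (inner ℝ u (x - y.1)) ^ 2 * f (dist x y.1)) ∧
      ∑ x ∈ P.motif, ∑' y : {y : EuclideanSpace ℝ (Fin 3) // y ∈ P.points ∧ y ≠ x},
        (inner ℝ u (x - y.1)) ^ 2 * f (dist x y.1) ≤ 0 :=
  -- LANDED (lead −1, p101492): `Theorems/ThreeConeCertificateExactCertificateSecondMoment.lean`.
  Summit.AtomisticToContinuum.Crystallization.Theorems.ThreeConeCertificateExactCertificate.Fourier.stub_secondMoment

/-! ## The field of the crystal (c1 lead's chain; all landed) -/

/-- **stub_cosetSummable — every coset family of an eventually non-positive positive-type radial kernel is summable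
at every offset (Field chain 0/3).** -/
theorem stub_cosetSummable : ∀ (P : PeriodicConfiguration 3) (f : ℝ → ℝ),
    (∀ (n : ℕ) (y : Fin n → EuclideanSpace ℝ (Fin 3)) (w : Fin n → ℝ),
      0 ≤ ∑ i, ∑ j, w i * w j * f (dist (y i) (y j))) →
    ∀ R : ℝ, (∀ r : ℝ, R ≤ r → f r ≤ 0) → ∀ v : EuclideanSpace ℝ (Fin 3),
      Summable fun d : Fin 3 → ℤ =>
        f (dist v (Summit.AtomisticToContinuum.Crystallization.Theorems.ChargedEnergyGapNegative.Blocks.latVec P d)) :=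
  -- LANDED (c1, p98572): `Theorems/ThreeConeCertificateExactCertificateFieldSummable.lean`.
  Summit.AtomisticToContinuum.Crystallization.Theorems.ThreeConeCertificateExactCertificate.Field.stub_cosetSummable

/-- **stub_periodisationPosType — the lattice periodisation of a positive-type radial kernel with summable coset
families is of positive type (Field chain 1/3).** -/
theorem stub_periodisationPosType : ∀ (P : PeriodicConfiguration 3) (f : ℝ → ℝ),
    (∀ (n : ℕ) (y : Fin n → EuclideanSpace ℝ (Fin 3)) (w : Fin n → ℝ),
      0 ≤ ∑ i, ∑ j, w i * w j * f (dist (y i) (y j))) →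
    (∀ v : EuclideanSpace ℝ (Fin 3), Summable fun d : Fin 3 → ℤ =>
      f (dist v (Summit.AtomisticToContinuum.Crystallization.Theorems.ChargedEnergyGapNegative.Blocks.latVec P d))) →
    ∀ (n : ℕ) (u : Fin n → EuclideanSpace ℝ (Fin 3)) (w : Fin n → ℝ),
      0 ≤ ∑ i, ∑ j, w i * w j * ∑' d : Fin 3 → ℤ,
        f (dist (u i - u j)
          (Summit.AtomisticToContinuum.Crystallization.Theorems.ChargedEnergyGapNegative.Blocks.latVec P d)) :=
  -- LANDED (c1, p101701): `Theorems/ThreeConeCertificateExactCertificateFieldPeriodic.lean`.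
  Summit.AtomisticToContinuum.Crystallization.Theorems.ThreeConeCertificateExactCertificate.Field.stub_periodisationPosType

/-- **stub_invisible — INVISIBILITY (Field chain 2/3, headline): a positive-type, eventually non-positive radial `f`
with `f 0 + 2e_f(P) = 0` has identically vanishing crystal field `Σ_{y ∈ P} f(dist w y) = 0` for EVERY `w`; applies to
every witness (`stub_coneEnergies` (iii)).** -/
theorem stub_invisible : ∀ (P : PeriodicConfiguration 3) (f : ℝ → ℝ),
    (∀ (n : ℕ) (y : Fin n → EuclideanSpace ℝ (Fin 3)) (w : Fin n → ℝ),
      0 ≤ ∑ i, ∑ j, w i * w j * f (dist (y i) (y j))) →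
    ∀ R : ℝ, (∀ r : ℝ, R ≤ r → f r ≤ 0) → f 0 + 2 * P.energyPerParticle f = 0 →
      ∀ w : EuclideanSpace ℝ (Fin 3),
        HasSum (fun y : P.points => f (dist w (y : EuclideanSpace ℝ (Fin 3)))) 0 :=
  -- LANDED (c1, p104609): `Theorems/ThreeConeCertificateExactCertificateFieldInvisible.lean`.
  Summit.AtomisticToContinuum.Crystallization.Theorems.ThreeConeCertificateExactCertificate.Field.stub_invisible

/-- **stub_competitorNeutrality — for a witness `(P, ρ, c, g, U, f)` and EVERY periodic `Q`:
`0 ≤ f 0 + 2e_f(Q) ≤ 2(e(Q) − e(P))` (near-optimal competitors are `f`-neutral within twice their excess energy; the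
rigorous core of the Barlow squeeze).  Lower bound: Bochner on `Q`-blocks (periodisation of positive type); upper bound:
the `f`-slack of `Q`-blocks is bounded by the excess energy (`Neg.IsSplit` cones + block trial states of `Q`) and block
sums converge to `2#F_Q K³ e_f(Q)` (summable site families).  Provable now, M.** -/
theorem stub_competitorNeutrality : ∀ (P Q : PeriodicConfiguration 3) (ρ c : ℝ) (g U f : ℝ → ℝ),
    Summit.AtomisticToContinuum.Crystallization.Theorems.ExactCertificateNegative.IsSplit ρ c g U f → c + f 0 / 2 ≤ -(P.energyPerParticle lennardJones) →
    0 ≤ f 0 + 2 * Q.energyPerParticle f ∧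
      f 0 + 2 * Q.energyPerParticle f ≤
        2 * (Q.energyPerParticle lennardJones - P.energyPerParticle lennardJones) :=
  -- LANDED (c2 wave 1, p113285): `Theorems/ThreeConeCertificateExactCertificateFieldCompetitors.lean`.
  Summit.AtomisticToContinuum.Crystallization.Theorems.ThreeConeCertificateExactCertificate.Field.stub_competitorNeutrality

/-- **stub_dilationDefect — DILATION DEFECT: for a witness and every `t > 0`,
`0 ≤ f 0 + 2e_P(f(t·)) ≤ (e₆(P)/6)(t⁻⁶ − 1)²` (apply `stub_competitorNeutrality` to the dilated template `t⁻¹ • P`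
via `stub_dilate`, and price its excess by `stub_zeroPressure` (iii); second-order vanishing at `t = 1` = double zeros
of `𝓕f` at the Bragg radii, Fourier-free).  Provable now, S/M.** -/
theorem stub_dilationDefect : ∀ (P : PeriodicConfiguration 3) (ρ c : ℝ) (g U f : ℝ → ℝ),
    Summit.AtomisticToContinuum.Crystallization.Theorems.ExactCertificateNegative.IsSplit ρ c g U f → c + f 0 / 2 ≤ -(P.energyPerParticle lennardJones) →
    ∀ t : ℝ, 0 < t →
      0 ≤ f 0 + 2 * P.energyPerParticle (fun r => f (t * r)) ∧
      f 0 + 2 * P.energyPerParticle (fun r => f (t * r)) ≤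
        (1 / 6) * P.energyPerParticle (fun r => (r⁻¹) ^ 6) * ((t⁻¹) ^ 6 - 1) ^ 2 :=
  -- LANDED (c2, p113958): `Theorems/ThreeConeCertificateExactCertificateFieldDilation.lean`.
  Summit.AtomisticToContinuum.Crystallization.Theorems.ThreeConeCertificateExactCertificate.Field.stub_dilationDefect

/-- **stub_templateNeutrality — MOVING TEMPLATE (no witness assumed): for every periodic `Q` and radial positive-type
`f` with `f ≤ V_LJ` beyond `ρ₀`: `0 ≤ f 0 + 2e_Q(f) ≤ f 0 + 2e_Q(f·1_{(0,ρ₀)}) + 2e_Q(V_LJ·1_{[ρ₀,∞)})` (the tail slack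
of `stub_noGap`).  Lower bound: Bochner on `Q`-blocks; upper bound: `f ≤ V_LJ` termwise on the tail.  Provable now, M.** -/
theorem stub_templateNeutrality : ∀ (Q : PeriodicConfiguration 3) (ρ₀ : ℝ) (f : ℝ → ℝ),
    (∀ (n : ℕ) (y : Fin n → EuclideanSpace ℝ (Fin 3)) (w : Fin n → ℝ),
      0 ≤ ∑ i, ∑ j, w i * w j * f (dist (y i) (y j))) →
    (∀ r : ℝ, ρ₀ ≤ r → 0 < r → f r ≤ lennardJones r) →
    0 ≤ f 0 + 2 * Q.energyPerParticle f ∧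
      f 0 + 2 * Q.energyPerParticle f ≤
        f 0 + 2 * Q.energyPerParticle (fun r => if r < ρ₀ then f r else 0) +
          2 * Q.energyPerParticle (fun r => if r < ρ₀ then 0 else lennardJones r) :=
  -- LANDED (c2 wave 1, p113243): `Theorems/ThreeConeCertificateExactCertificateFieldMoving.lean`.
  Summit.AtomisticToContinuum.Crystallization.Theorems.ThreeConeCertificateExactCertificate.Field.stub_templateNeutrality

/-- **stub_nearDefect — the LP rows at every probe point: for a witness with `0 < ρ` and every `w ∈ ℝ³`, with
`s = {y ∈ P : dist w y < ρ}` (finite), `0 ≤ Σ_{y ∈ s} f(dist w y) + Σ'_{y ∉ s} V_LJ(dist w y)`, with equality for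
`w ∈ P` (invisibility `Σ_{y∈P} f(dist w y) = 0` + `f ≤ V_LJ` beyond `ρ`, `= V_LJ` on `D_P`).  Provable now, M.** -/
theorem stub_nearDefect : ∀ (P : PeriodicConfiguration 3) (ρ c : ℝ) (g U f : ℝ → ℝ),
    Summit.AtomisticToContinuum.Crystallization.Theorems.ExactCertificateNegative.IsSplit ρ c g U f → c + f 0 / 2 ≤ -(P.energyPerParticle lennardJones) → 0 < ρ →
    ∀ w : EuclideanSpace ℝ (Fin 3), ∃ s : Finset P.points,
      (∀ y : P.points, y ∈ s ↔ dist w (y : EuclideanSpace ℝ (Fin 3)) < ρ) ∧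
      0 ≤ ∑ y ∈ s, f (dist w (y : EuclideanSpace ℝ (Fin 3))) +
          ∑' y : {y : P.points // y ∉ s}, lennardJones (dist w (y : EuclideanSpace ℝ (Fin 3))) ∧
      (w ∈ P.points →
        ∑ y ∈ s, f (dist w (y : EuclideanSpace ℝ (Fin 3))) +
          ∑' y : {y : P.points // y ∉ s}, lennardJones (dist w (y : EuclideanSpace ℝ (Fin 3))) = 0) :=
  -- LANDED (c2 wave 1, p113147): `Theorems/ThreeConeCertificateExactCertificateFieldNear.lean`.
  Summit.AtomisticToContinuum.Crystallization.Theorems.ThreeConeCertificateExactCertificate.Field.stub_nearDefect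

/-! ## The open half, periodic form (lead c2) -/

/-- **stub_sharpSplitPeriodic — `SharpSplit` IS A STATEMENT ABOUT PERIODIC CONFIGURATIONS ONLY (lead c2;
provable now, M).**  `SharpSplit` (= `stub_noGap`, the crux's open content besides 11961) holds iff there are a
range `ρ` and a radial positive-type `f` with `f ≤ V_LJ` on `[ρ,∞) ∩ (0,∞)` such that EVERY periodic
configuration `Q` of `ℝ³` has `e* + f 0/2 ≤ e_Q((V_LJ − f)·1_{(0,ρ)})` — the designed finite-range potential
`g_f = (V_LJ − f)1_{(0,ρ)}` has PERIODIC ground-state energy (at least, hence exactly) `e* + f 0/2`.  No finite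
configuration, no stability constant, no `U`, no `c` remains: `→` is core weak duality on `Q`-blocks
(`Slackness.const_le_energyPerParticle_of_stable`); `←` is periodisation of a finite injective `x` with a period
exceeding `diam x + ρ`, whose copies do not interact under the finite-range `g_f`, so `e_{Q_x}(g_f) = E_{g_f}(x)/N`.
Equivalently (lattice-sum accounting): `∀ Q, f 0 + 2e_Q(f·1_{(0,ρ)}) + 2e_Q(V_LJ·1_{[ρ,∞)}) ≤ 2(e_Q(V_LJ) − e*)` —
the tail-slack functional of `stub_noGap` is dominated by twice the excess energy of every periodic competitor. -/
theorem stub_sharpSplitPeriodic :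
    (∃ (ρ c : ℝ) (g U f : ℝ → ℝ),
      Summit.AtomisticToContinuum.Crystallization.Theorems.ExactCertificateNegative.IsSplit ρ c g U f ∧
        c + f 0 / 2 = -Summit.AtomisticToContinuum.Crystallization.Theorems.ChargedEnergyGapNegative.eStar) ↔
    ∃ (ρ : ℝ) (f : ℝ → ℝ),
      (∀ (n : ℕ) (y : Fin n → EuclideanSpace ℝ (Fin 3)) (w : Fin n → ℝ),
        0 ≤ ∑ i, ∑ j, w i * w j * f (dist (y i) (y j))) ∧
      (∀ r : ℝ, ρ ≤ r → 0 < r → f r ≤ lennardJones r) ∧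
      ∀ Q : PeriodicConfiguration 3,
        Summit.AtomisticToContinuum.Crystallization.Theorems.ChargedEnergyGapNegative.eStar + f 0 / 2 ≤
          Q.energyPerParticle (fun r => if r < ρ then lennardJones r - f r else 0) :=
  -- LANDED (c2, p111914): `Theorems/ThreeConeCertificateExactCertificateNoGapPeriodic.lean`.
  Summit.AtomisticToContinuum.Crystallization.Theorems.ThreeConeCertificateExactCertificate.NoGap.stub_sharpSplitPeriodic

/-- **stub_noGapPeriodic — the open stub `stub_noGap` in PERIODIC-ONLY form (lead c2; provable now, S).**  The core
clause of `stub_noGap` ("`Q` is an `ε`-ground state of `g_f = (V_LJ − f)1_{(0,ρ₀)}` among ALL finite injective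
configurations") is equivalent to its periodic form "`e_Q(g_f) − ε ≤ e_{Q'}(g_f)` for every periodic `Q'`"
(`NoGap.stable_of_periodic_bound` + `Slackness.const_le_energyPerParticle_of_stable`): every object in the open half of
the crux is a lattice sum over a periodic configuration. -/
theorem stub_noGapPeriodic :
    (∃ ρ₀ : ℝ, ∀ ε : ℝ, 0 < ε → ∃ (Q : PeriodicConfiguration 3) (f : ℝ → ℝ),
      (∀ (n : ℕ) (y : Fin n → EuclideanSpace ℝ (Fin 3)) (w : Fin n → ℝ),
        0 ≤ ∑ i, ∑ j, w i * w j * f (dist (y i) (y j))) ∧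
      (∀ r : ℝ, ρ₀ ≤ r → 0 < r → f r ≤ lennardJones r) ∧
      f 0 + 2 * Q.energyPerParticle (fun r => if r < ρ₀ then f r else 0) +
          2 * Q.energyPerParticle (fun r => if r < ρ₀ then 0 else lennardJones r) ≤ ε ∧
      (∀ (N : ℕ) (x : Fin N → EuclideanSpace ℝ (Fin 3)), Function.Injective x →
        (N : ℝ) * (Q.energyPerParticle (fun r => if r < ρ₀ then lennardJones r - f r else 0) - ε) ≤
          interactionEnergy (fun r => if r < ρ₀ then lennardJones r - f r else 0) x)) ↔
    (∃ ρ₀ : ℝ, ∀ ε : ℝ, 0 < ε → ∃ (Q : PeriodicConfiguration 3) (f : ℝ → ℝ),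
      (∀ (n : ℕ) (y : Fin n → EuclideanSpace ℝ (Fin 3)) (w : Fin n → ℝ),
        0 ≤ ∑ i, ∑ j, w i * w j * f (dist (y i) (y j))) ∧
      (∀ r : ℝ, ρ₀ ≤ r → 0 < r → f r ≤ lennardJones r) ∧
      f 0 + 2 * Q.energyPerParticle (fun r => if r < ρ₀ then f r else 0) +
          2 * Q.energyPerParticle (fun r => if r < ρ₀ then 0 else lennardJones r) ≤ ε ∧
      ∀ Q' : PeriodicConfiguration 3,
        Q.energyPerParticle (fun r => if r < ρ₀ then lennardJones r - f r else 0) - ε ≤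
          Q'.energyPerParticle (fun r => if r < ρ₀ then lennardJones r - f r else 0)) :=
  -- LANDED (c2, p112094): `Theorems/ThreeConeCertificateExactCertificateNoGapPeriodicEps.lean`.
  Summit.AtomisticToContinuum.Crystallization.Theorems.ThreeConeCertificateExactCertificate.NoGap.stub_noGapPeriodic

/-! ## Load-bearing and asymptotic stubs (c1 lead's; `withoutStability`, `asymptoticKernel` landed) -/

/-- **stub_withoutStability — the crux with the stability clause (S5) dropped holds for EVERY periodic template (the
cone split is feasible: an explicit Gaussian–Bernstein kernel is PD on `ℝ³` and `≤ V_LJ` on `[8,∞)`).** -/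
theorem stub_withoutStability : ∀ P : PeriodicConfiguration 3, ∃ (ρ c : ℝ) (g U f : ℝ → ℝ),
    (∀ r : ℝ, 0 < r → lennardJones r = g r + U r + f r) ∧ (∀ r : ℝ, 0 < r → 0 ≤ U r) ∧
    (∀ r : ℝ, ρ ≤ r → g r = 0) ∧
    (∀ (n : ℕ) (y : Fin n → EuclideanSpace ℝ (Fin 3)) (w : Fin n → ℝ),
      0 ≤ ∑ i, ∑ j, w i * w j * f (dist (y i) (y j))) ∧
    c + f 0 / 2 = -(P.energyPerParticle lennardJones) :=
  -- LANDED (c1, p107137): `Theorems/ThreeConeCertificateExactCertificateFeasible.lean`.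
  Summit.AtomisticToContinuum.Crystallization.Theorems.ThreeConeCertificateExactCertificate.Feasible.stub_withoutStability

/-- **stub_asymptoticKernel — the cheap Bochner cones `f_ρ = (135/ρ³)e^{−d²} − 5∫₀^{9/ρ²} u²e^{−ud²}du` (`ρ ≥ 1000`):
radially PD on `ℝ³`, charge `≤ 135/ρ³`, below `V_LJ` on `[ρ,∞)`.** -/
theorem stub_asymptoticKernel : ∀ ρ : ℝ, 1000 ≤ ρ →
    (∀ (n : ℕ) (y : Fin n → EuclideanSpace ℝ (Fin 3)) (w : Fin n → ℝ),
      0 ≤ ∑ i, ∑ j, w i * w j * (135 / ρ ^ 3 * Real.exp (-1 * dist (y i) (y j) ^ 2) -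
        5 * ∫ u in (0 : ℝ)..(9 / ρ ^ 2), u ^ 2 * Real.exp (-u * dist (y i) (y j) ^ 2))) ∧
    (135 / ρ ^ 3 * Real.exp (-1 * (0 : ℝ) ^ 2) -
      5 * ∫ u in (0 : ℝ)..(9 / ρ ^ 2), u ^ 2 * Real.exp (-u * (0 : ℝ) ^ 2)) ≤ 135 / ρ ^ 3 ∧
    ∀ d : ℝ, ρ ≤ d → (135 / ρ ^ 3 * Real.exp (-1 * d ^ 2) -
      5 * ∫ u in (0 : ℝ)..(9 / ρ ^ 2), u ^ 2 * Real.exp (-u * d ^ 2)) ≤ lennardJones d :=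
  -- LANDED (c1, p107933): `Theorems/ThreeConeCertificateExactCertificateAsymptoticKernel.lean`.
  Summit.AtomisticToContinuum.Crystallization.Theorems.ThreeConeCertificateExactCertificate.Asymptotic.stub_asymptoticKernel

/-- **stub_splitOfKernel — FROM A CHEAP BOCHNER CONE TO A NEAR-OPTIMAL SPLIT (lead c2; kernel-agnostic
reduction, provable now, M).**  Let `ρ ≥ 1000` and `f` be radially of positive type with small charge
`f 0 ≤ 135/ρ³`, `f ≤ 0` on `[ρ^{1/4}, ρ]` and `f ≤ V_LJ` on `[ρ,∞)`.  Then the normal-form split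
`g := (V_LJ − f)1_{(0,ρ)}`, `U := (V_LJ − f)1_{[ρ,∞)}` is a range-`ρ` three-cone split of value
`c + f 0/2 ≤ −e* + K/ρ`, `K = 8·810·2³²/12 + 135`.  Mechanism: pointwise on `(0,∞)`
`g ≥ (1 − μ)V_LJ + μ·8V_LJ(4^{1/6}·)` with `μ = 810/ρ^{3/2}` (below `ρ^{1/4}`: `f ≤ f 0 ≤ 135/ρ³ ≤ μr⁻⁶/6`; on
`[ρ^{1/4}, ρ)`: `f ≤ 0 ≤ μ(r⁻¹²/24 + r⁻⁶/6)`; beyond `ρ`: both potentials `≤ 0 = g`), hence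
`E_g ≥ (1−μ)N e* − μ·8·(2³²/12)N` (`card_mul_eStar_le_interactionEnergy`; the tree's explicit LJ stability
`le_interactionEnergy_lennardJones` on the dilated configuration `4^{1/6} • x`), and `e* < 0` (dimer). -/
theorem stub_splitOfKernel : ∀ (ρ : ℝ) (f : ℝ → ℝ), 1000 ≤ ρ →
    (∀ (n : ℕ) (y : Fin n → EuclideanSpace ℝ (Fin 3)) (w : Fin n → ℝ),
      0 ≤ ∑ i, ∑ j, w i * w j * f (dist (y i) (y j))) →
    f 0 ≤ 135 / ρ ^ 3 → (∀ d : ℝ, Real.sqrt (Real.sqrt ρ) ≤ d → d ≤ ρ → f d ≤ 0) →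
    (∀ d : ℝ, ρ ≤ d → f d ≤ lennardJones d) →
    ∃ (c : ℝ) (g U : ℝ → ℝ), Summit.AtomisticToContinuum.Crystallization.Theorems.ExactCertificateNegative.IsSplit ρ c g U f ∧
      c + f 0 / 2 ≤ -Summit.AtomisticToContinuum.Crystallization.Theorems.ChargedEnergyGapNegative.eStar + (8 * 810 * (65536 ^ 2 / 12) + 135) / ρ :=
  -- LANDED (c2, p111463): `Theorems/ThreeConeCertificateExactCertificateAsymptoticSplit.lean`.
  Summit.AtomisticToContinuum.Crystallization.Theorems.ThreeConeCertificateExactCertificate.Asymptotic.stub_splitOfKernel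

/-- **stub_asymptoticNoGap — ASYMPTOTIC NO-GAP (registered by c1; = `stub_splitOfKernel` + the kernel facts of
`stub_asymptoticKernel`): for every `ε > 0` there is a finite-range three-cone split of `V_LJ` of value
`c + f 0/2 ≤ −e* + ε`** (range `ρ = max 1000 (K/ε)`, the cheap Bochner cone `f_ρ`).  With `IsSplit.value_ge`: the
infimum of the programme over all finite ranges is EXACTLY `−e*`, so `stub_noGap`/SharpSplit = attainment at a finite
range. -/
theorem stub_asymptoticNoGap : ∀ ε : ℝ, 0 < ε → ∃ (ρ c : ℝ) (g U f : ℝ → ℝ),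
    Summit.AtomisticToContinuum.Crystallization.Theorems.ExactCertificateNegative.IsSplit ρ c g U f ∧ c + f 0 / 2 ≤ -Summit.AtomisticToContinuum.Crystallization.Theorems.ChargedEnergyGapNegative.eStar + ε :=
  -- LANDED (c2, p112093): `Theorems/ThreeConeCertificateExactCertificateAsymptoticNoGap.lean`.
  Summit.AtomisticToContinuum.Crystallization.Theorems.ThreeConeCertificateExactCertificate.Asymptotic.stub_asymptoticNoGap

/-- **stub_existsSplit — a STABLE three-cone split of `V_LJ` exists** (so the crux with the value equation (S6)
dropped holds; with `stub_withoutStability` the load-bearing table is complete: the content of the crux is the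
SHARPNESS of the value plus attainment).  Corollary of `stub_asymptoticNoGap` (`ε = 1`). -/
theorem stub_existsSplit : ∃ (ρ c : ℝ) (g U f : ℝ → ℝ), Summit.AtomisticToContinuum.Crystallization.Theorems.ExactCertificateNegative.IsSplit ρ c g U f :=
  -- LANDED (c2, p112093): `Theorems/ThreeConeCertificateExactCertificateAsymptoticNoGap.lean`.
  Summit.AtomisticToContinuum.Crystallization.Theorems.ThreeConeCertificateExactCertificate.Asymptotic.stub_existsSplit

/-! ## Proved glue (sorry-free below this line) -/

/-- Ambient space `ℝ³` (used only in the proved part). -/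
abbrev E3 : Type := EuclideanSpace ℝ (Fin 3)

/-! ### Weak duality `−e* ≤ c + f 0/2` is `IsSplit.value_ge` of `Negative/SplitBasics` (landed). -/

/-- `stub_periodicMinimum` is NECESSARY: a witness configuration of the crux is a periodic minimiser
(weak duality). -/
theorem periodicMinimum_of_exact (h : ExactCertificate) :
    ∃ P : PeriodicConfiguration 3, ∀ Q : PeriodicConfiguration 3,
      P.energyPerParticle lennardJones ≤ Q.energyPerParticle lennardJones := by
  obtain ⟨P, ρ, c, g, U, f, h1, h2, h3, h4, h5, h6⟩ := h
  have hs : IsSplit ρ c g U f := ⟨h1, h2, h3, h4, h5⟩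
  have hv := hs.value_ge
  refine ⟨P, fun Q => ?_⟩
  have := eStar_le Q
  linarith

/-! ### Lattice-sum accounting for truncated potentials -/

/-- A site family of a potential vanishing on `[ρ,∞)` has finite support on a periodic configuration. -/
theorem finite_support_of_finRange (Q : PeriodicConfiguration 3) {W : ℝ → ℝ} {ρ : ℝ}
    (hW : ∀ r, ρ ≤ r → W r = 0) (p : E3) :
    (Function.support fun q : {q : E3 // q ∈ Q.points ∧ q ≠ p} => W (dist p q.1)).Finite := by
  have hfin := Q.finite_inter_points (Metric.isBounded_ball (x := p) (r := ρ))
  refine (hfin.preimage Subtype.val_injective.injOn).subset ?_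
  intro q hq
  refine ⟨?_, q.2.1⟩
  rw [Metric.mem_ball, dist_comm]
  by_contra hle
  exact hq (hW _ (not_lt.1 hle))

theorem summable_of_finRange (Q : PeriodicConfiguration 3) {W : ℝ → ℝ} {ρ : ℝ}
    (hW : ∀ r, ρ ≤ r → W r = 0) (p : E3) :
    Summable fun q : {q : E3 // q ∈ Q.points ∧ q ≠ p} => W (dist p q.1) :=
  summable_of_hasFiniteSupport (finite_support_of_finRange Q hW p)

/-- Two potentials agreeing on `(0,∞)` have the same energy per particle. -/
theorem energyPerParticle_congr_pos (Q : PeriodicConfiguration 3) {W W' : ℝ → ℝ}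
    (h : ∀ r, 0 < r → W r = W' r) : Q.energyPerParticle W = Q.energyPerParticle W' := by
  unfold PeriodicConfiguration.energyPerParticle
  congr 1
  refine Finset.sum_congr rfl fun x _ => tsum_congr fun q => h _ ?_
  exact dist_pos.2 fun heq => q.2.2 heq.symm

/-- Additivity of the energy per particle for summable site families. -/
theorem energyPerParticle_add (Q : PeriodicConfiguration 3) {W₁ W₂ : ℝ → ℝ}
    (h₁ : ∀ x ∈ Q.motif, Summable fun q : {y : E3 // y ∈ Q.points ∧ y ≠ x} => W₁ (dist x q.1))
    (h₂ : ∀ x ∈ Q.motif, Summable fun q : {y : E3 // y ∈ Q.points ∧ y ≠ x} => W₂ (dist x q.1)) :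
    Q.energyPerParticle (fun r => W₁ r + W₂ r) = Q.energyPerParticle W₁ + Q.energyPerParticle W₂ := by
  unfold PeriodicConfiguration.energyPerParticle
  rw [← mul_add, ← Finset.sum_add_distrib]
  congr 1
  exact Finset.sum_congr rfl fun x hx => (h₁ x hx).tsum_add (h₂ x hx)

/-- The energy per particle is odd in the potential (no summability needed). -/
theorem energyPerParticle_neg (Q : PeriodicConfiguration 3) (W : ℝ → ℝ) :
    Q.energyPerParticle (fun r => -W r) = -Q.energyPerParticle W := by
  unfold PeriodicConfiguration.energyPerParticle
  rw [← mul_neg, ← Finset.sum_neg_distrib]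
  congr 1
  exact Finset.sum_congr rfl fun x _ => tsum_neg

/-- Truncation of a potential to the core `(−∞, ρ)` … -/
def core (ρ : ℝ) (W : ℝ → ℝ) : ℝ → ℝ := fun r => if r < ρ then W r else 0

/-- … and to the tail `[ρ, ∞)` (proof-side names for the lambdas occurring in the stubs). -/
def tail (ρ : ℝ) (W : ℝ → ℝ) : ℝ → ℝ := fun r => if r < ρ then 0 else W r

theorem core_eq_zero (ρ : ℝ) (W : ℝ → ℝ) : ∀ r, ρ ≤ r → core ρ W r = 0 := fun r hr => by
  unfold core
  rw [if_neg (not_lt.2 hr)]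

theorem core_neg (ρ : ℝ) (f : ℝ → ℝ) : ∀ r, core ρ (fun s => -f s) r = -(core ρ f r) := fun r => by
  unfold core
  by_cases hr : r < ρ
  · rw [if_pos hr, if_pos hr]
  · rw [if_neg hr, if_neg hr, neg_zero]

theorem summable_core (Q : PeriodicConfiguration 3) (ρ : ℝ) (W : ℝ → ℝ) (p : E3) :
    Summable fun q : {q : E3 // q ∈ Q.points ∧ q ≠ p} => core ρ W (dist p q.1) :=
  summable_of_finRange Q (W := core ρ W) (core_eq_zero ρ W) p

/-- `e_Q(V_LJ) = e_Q(V_LJ·1_{(0,ρ)}) + e_Q(V_LJ·1_{[ρ,∞)})`. -/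
theorem energyPerParticle_split_range (Q : PeriodicConfiguration 3) (ρ : ℝ) :
    Q.energyPerParticle lennardJones =
      Q.energyPerParticle (core ρ lennardJones) + Q.energyPerParticle (tail ρ lennardJones) := by
  have h₁ : ∀ x ∈ Q.motif, Summable fun q : {y : E3 // y ∈ Q.points ∧ y ≠ x} =>
      core ρ lennardJones (dist x q.1) := fun x _ => summable_core Q ρ lennardJones x
  have h₂ : ∀ x ∈ Q.motif, Summable fun q : {y : E3 // y ∈ Q.points ∧ y ≠ x} =>
      tail ρ lennardJones (dist x q.1) := fun x hx => by
    refine ((Q.summable_lennardJones_dist_three x).sub (h₁ x hx)).congr fun q => ?_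
    show lennardJones (dist x q.1) - core ρ lennardJones (dist x q.1) = tail ρ lennardJones (dist x q.1)
    unfold core tail
    by_cases hq : dist x q.1 < ρ
    · rw [if_pos hq, if_pos hq, sub_self]
    · rw [if_neg hq, if_neg hq, sub_zero]
  rw [← energyPerParticle_add Q h₁ h₂]
  refine energyPerParticle_congr_pos Q fun r _ => ?_
  show lennardJones r = core ρ lennardJones r + tail ρ lennardJones r
  unfold core tail
  by_cases hr : r < ρ
  · rw [if_pos hr, if_pos hr, add_zero]
  · rw [if_neg hr, if_neg hr, zero_add]

/-- `e_Q((V_LJ − f)·1_{(0,ρ)}) = e_Q(V_LJ·1_{(0,ρ)}) − e_Q(f·1_{(0,ρ)})` (finite sums). -/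
theorem energyPerParticle_core_sub (Q : PeriodicConfiguration 3) (ρ : ℝ) (f : ℝ → ℝ) :
    Q.energyPerParticle (core ρ fun r => lennardJones r - f r) =
      Q.energyPerParticle (core ρ lennardJones) - Q.energyPerParticle (core ρ f) := by
  have h₁ : ∀ x ∈ Q.motif, Summable fun q : {y : E3 // y ∈ Q.points ∧ y ≠ x} =>
      core ρ lennardJones (dist x q.1) := fun x _ => summable_core Q ρ lennardJones x
  have h₂ : ∀ x ∈ Q.motif, Summable fun q : {y : E3 // y ∈ Q.points ∧ y ≠ x} =>
      core ρ (fun s => -f s) (dist x q.1) := fun x _ => summable_core Q ρ (fun s => -f s) x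
  have hneg : Q.energyPerParticle (core ρ fun s => -f s) = -Q.energyPerParticle (core ρ f) := by
    rw [← energyPerParticle_neg Q (core ρ f)]
    exact energyPerParticle_congr_pos Q fun r _ => core_neg ρ f r
  rw [sub_eq_add_neg, ← hneg, ← energyPerParticle_add Q h₁ h₂]
  refine energyPerParticle_congr_pos Q fun r _ => ?_
  show core ρ (fun r => lennardJones r - f r) r = core ρ lennardJones r + core ρ (fun s => -f s) r
  unfold core
  by_cases hr : r < ρ
  · rw [if_pos hr, if_pos hr, if_pos hr]; ring
  · rw [if_neg hr, if_neg hr, if_neg hr]; ring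

/-! ### The normal-form split and the composition -/

/-- **Normal form.**  A radial positive-type `f` below `V_LJ` beyond `ρ`, whose core remainder
`g_f = (V_LJ − f)·1_{(0,ρ)}` has `Q` as an `ε`-approximate per-particle ground state and whose tail slack
is `≤ ε`, yields a range-`ρ` split of value `≤ −e_LJ(Q) + 3ε/2`:
`g := g_f`, `U := (V_LJ − f)·1_{[ρ,∞)}`, `c := ε − e_Q(g_f)`. -/
theorem split_of_twoSlack (Q : PeriodicConfiguration 3) (ρ ε : ℝ) (f : ℝ → ℝ)
    (hpd : ∀ (n : ℕ) (y : Fin n → E3) (w : Fin n → ℝ), 0 ≤ ∑ i, ∑ j, w i * w j * f (dist (y i) (y j)))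
    (htail : ∀ r : ℝ, ρ ≤ r → 0 < r → f r ≤ lennardJones r)
    (hT : f 0 + 2 * Q.energyPerParticle (fun r => if r < ρ then f r else 0)
          + 2 * Q.energyPerParticle (fun r => if r < ρ then 0 else lennardJones r) ≤ ε)
    (hC : ∀ (N : ℕ) (x : Fin N → E3), Function.Injective x →
        (N : ℝ) * (Q.energyPerParticle (fun r => if r < ρ then lennardJones r - f r else 0) - ε) ≤
          interactionEnergy (fun r => if r < ρ then lennardJones r - f r else 0) x) :
    ∃ (c : ℝ) (g U : ℝ → ℝ), IsSplit ρ c g U f ∧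
      c + f 0 / 2 ≤ -(Q.energyPerParticle lennardJones) + 3 * ε / 2 := by
  set eg : ℝ := Q.energyPerParticle (fun r => if r < ρ then lennardJones r - f r else 0) with heg
  refine ⟨ε - eg, fun r => if r < ρ then lennardJones r - f r else 0,
    fun r => if r < ρ then 0 else lennardJones r - f r, ⟨?_, ?_, ?_, hpd, ?_⟩, ?_⟩
  · intro r _
    show lennardJones r =
      (if r < ρ then lennardJones r - f r else 0) + (if r < ρ then 0 else lennardJones r - f r) + f r
    by_cases h : r < ρ
    · rw [if_pos h, if_pos h]; ring
    · rw [if_neg h, if_neg h]; ring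
  · intro r hr
    show 0 ≤ (if r < ρ then 0 else lennardJones r - f r)
    by_cases h : r < ρ
    · rw [if_pos h]
    · rw [if_neg h, sub_nonneg]
      exact htail r (not_lt.1 h) hr
  · intro r hr
    show (if r < ρ then lennardJones r - f r else 0) = 0
    rw [if_neg (not_lt.2 hr)]
  · intro N x hx
    have h1 := hC N x hx
    have e1 : -((ε - eg) * (N : ℝ)) = (N : ℝ) * (eg - ε) := by ring
    rw [e1]
    exact h1
  · -- lattice-sum accounting: value = CoreSlack + ½·TailSlack − e(Q)
    have hV : Q.energyPerParticle lennardJones =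
        Q.energyPerParticle (fun r => if r < ρ then lennardJones r else 0) +
          Q.energyPerParticle (fun r => if r < ρ then 0 else lennardJones r) :=
      energyPerParticle_split_range Q ρ
    have hg : eg = Q.energyPerParticle (fun r => if r < ρ then lennardJones r else 0) -
          Q.energyPerParticle (fun r => if r < ρ then f r else 0) := by
      rw [heg]
      exact energyPerParticle_core_sub Q ρ f
    linarith

/-- From `stub_noGap`: near-optimal splits at range `ρ₀` relative to the floor `−e*`
(`NoGapAt ρ₀` of the idea card, P-free). -/
theorem noGapAt_of_twoSlack {ρ₀ : ℝ}
    (h : ∀ ε : ℝ, 0 < ε → ∃ (Q : PeriodicConfiguration 3) (f : ℝ → ℝ),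
      (∀ (n : ℕ) (y : Fin n → E3) (w : Fin n → ℝ), 0 ≤ ∑ i, ∑ j, w i * w j * f (dist (y i) (y j))) ∧
      (∀ r : ℝ, ρ₀ ≤ r → 0 < r → f r ≤ lennardJones r) ∧
      f 0 + 2 * Q.energyPerParticle (fun r => if r < ρ₀ then f r else 0)
          + 2 * Q.energyPerParticle (fun r => if r < ρ₀ then 0 else lennardJones r) ≤ ε ∧
      (∀ (N : ℕ) (x : Fin N → E3), Function.Injective x →
        (N : ℝ) * (Q.energyPerParticle (fun r => if r < ρ₀ then lennardJones r - f r else 0) - ε) ≤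
          interactionEnergy (fun r => if r < ρ₀ then lennardJones r - f r else 0) x)) :
    ∀ ε : ℝ, 0 < ε → ∃ (c : ℝ) (g U f : ℝ → ℝ), IsSplit ρ₀ c g U f ∧ c + f 0 / 2 ≤ -eStar + ε := by
  intro ε hε
  obtain ⟨Q, f, hpd, htail, hT, hC⟩ := h (ε / 2) (by positivity)
  obtain ⟨c, g, U, hs, hv⟩ := split_of_twoSlack Q ρ₀ (ε / 2) f hpd htail hT hC
  refine ⟨c, g, U, f, hs, ?_⟩
  have hQ := eStar_le Q
  linarith

/-! ### Zero pressure for periodic minimisers and witness templates (glue over the v3 stubs) -/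

/-- A periodic minimiser does not gain under dilation of the potential (`stub_dilate`), hence satisfies
the virial identity, `e_LJ(P) = −e₆(P)/12`, and the explicit dilation excess (`stub_zeroPressure`). -/
theorem zeroPressure_of_periodicMinimum {P : PeriodicConfiguration 3}
    (hP : ∀ Q : PeriodicConfiguration 3,
      P.energyPerParticle lennardJones ≤ Q.energyPerParticle lennardJones) :
    P.energyPerParticle (fun r => (r⁻¹) ^ 6) = P.energyPerParticle (fun r => (r⁻¹) ^ 12) ∧
    P.energyPerParticle lennardJones = -(1 / 12) * P.energyPerParticle (fun r => (r⁻¹) ^ 6) ∧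
    ∀ t : ℝ, 0 < t →
      P.energyPerParticle (fun r => lennardJones (t * r)) - P.energyPerParticle lennardJones =
        (1 / 12) * P.energyPerParticle (fun r => (r⁻¹) ^ 6) * ((t⁻¹) ^ 6 - 1) ^ 2 := by
  refine stub_zeroPressure P fun t ht => ?_
  obtain ⟨Q, -, -, hQ⟩ := stub_dilate P t ht
  rw [← hQ]
  exact hP Q

/-- A witness template of the crux is a periodic minimiser (weak duality), hence at zero pressure. -/
theorem zeroPressure_of_witness {P : PeriodicConfiguration 3} {ρ c : ℝ} {g U f : ℝ → ℝ}
    (h : IsSplit ρ c g U f) (hv : c + f 0 / 2 ≤ -(P.energyPerParticle lennardJones)) :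
    P.energyPerParticle (fun r => (r⁻¹) ^ 6) = P.energyPerParticle (fun r => (r⁻¹) ^ 12) ∧
    P.energyPerParticle lennardJones = -(1 / 12) * P.energyPerParticle (fun r => (r⁻¹) ^ 6) ∧
    ∀ t : ℝ, 0 < t →
      P.energyPerParticle (fun r => lennardJones (t * r)) - P.energyPerParticle lennardJones =
        (1 / 12) * P.energyPerParticle (fun r => (r⁻¹) ^ 6) * ((t⁻¹) ^ 6 - 1) ^ 2 := by
  refine zeroPressure_of_periodicMinimum fun Q => ?_
  have hge := h.value_ge
  have hQ := eStar_le Q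
  linarith

/-- **The line's tightness, inside the skeleton**: `ExactCertificate ↔ stub_noGap ∧ stub_periodicMinimum`
(from `stub_necessity` and the composition glue; equals `stub_iff` once that lands). -/
theorem ExactCertificate_iff_stubs : ExactCertificate ↔
    ((∃ ρ₀ : ℝ, ∀ ε : ℝ, 0 < ε → ∃ (Q : PeriodicConfiguration 3) (f : ℝ → ℝ),
      (∀ (n : ℕ) (y : Fin n → EuclideanSpace ℝ (Fin 3)) (w : Fin n → ℝ),
        0 ≤ ∑ i, ∑ j, w i * w j * f (dist (y i) (y j))) ∧
      (∀ r : ℝ, ρ₀ ≤ r → 0 < r → f r ≤ lennardJones r) ∧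
      f 0 + 2 * Q.energyPerParticle (fun r => if r < ρ₀ then f r else 0) +
          2 * Q.energyPerParticle (fun r => if r < ρ₀ then 0 else lennardJones r) ≤ ε ∧
      (∀ (N : ℕ) (x : Fin N → EuclideanSpace ℝ (Fin 3)), Function.Injective x →
        (N : ℝ) * (Q.energyPerParticle (fun r => if r < ρ₀ then lennardJones r - f r else 0) - ε) ≤
          interactionEnergy (fun r => if r < ρ₀ then lennardJones r - f r else 0) x)) ∧
    (∃ P : PeriodicConfiguration 3, ∀ Q : PeriodicConfiguration 3,
      P.energyPerParticle lennardJones ≤ Q.energyPerParticle lennardJones)) := by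
  refine ⟨stub_necessity, fun ⟨hng, hP⟩ => ?_⟩
  obtain ⟨ρ₀, hng⟩ := hng
  have hN := noGapAt_of_twoSlack hng
  obtain ⟨c, g, U, f, hS, hv⟩ := stub_closure ρ₀ (-eStar) hN
  have hs : IsSplit ρ₀ c g U f := hS
  have hge := hs.value_ge
  obtain ⟨P, hP⟩ := hP
  have heP : P.energyPerParticle lennardJones = eStar :=
    le_antisymm (le_ciInf hP) (eStar_le P)
  obtain ⟨h1, h2, h3, h4, h5⟩ := hS
  refine ⟨P, ρ₀, c, g, U, f, h1, h2, h3, h4, h5, ?_⟩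
  rw [heP]
  linarith

/-- **The value of the three-cone programme over all finite ranges is exactly `−e*`** (two-sided: the floor
`IsSplit.value_ge` and `stub_asymptoticNoGap`): for every `ε > 0` some finite-range split has
`−e* ≤ c + f 0/2 ≤ −e* + ε`.  So `stub_noGap` (↔ SharpSplit) asks precisely for ATTAINMENT at a finite range. -/
theorem value_sandwich (ε : ℝ) (hε : 0 < ε) : ∃ (ρ c : ℝ) (g U f : ℝ → ℝ),
    IsSplit ρ c g U f ∧ -eStar ≤ c + f 0 / 2 ∧ c + f 0 / 2 ≤ -eStar + ε := by
  obtain ⟨ρ, c, g, U, f, h, hv⟩ := stub_asymptoticNoGap ε hε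
  exact ⟨ρ, c, g, U, f, h, h.value_ge, hv⟩

/-- **Composition.**  `stub_noGap` ⇒ near-optimal splits at `ρ₀`; `stub_closure` at level `−e*` ⇒ a
split of value `≤ −e*`; weak duality ⇒ `= −e*`; `stub_periodicMinimum` (⇔ `KeplerBound`) ⇒ a periodic `P` with
`e(P) = e*`; hence the crux with (S6) as an equation — the `←` direction of `ExactCertificate_iff_stubs`
applied to the two open stubs (route-level form landed: `Split.ExactCertificate_of_subs`, p116973). -/
theorem ExactCertificate_of : ExactCertificate :=
  ExactCertificate_iff_stubs.2 ⟨stub_noGap, stub_periodicMinimum⟩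

end Summit.AtomisticToContinuum.Crystallization.Cruxes.ExactCertificate.ClosureMakesNogapExact

end
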